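import Mathlib
import Summits.MatrixMultiplication.Statement
import Summits.MatrixMultiplication.MatrixMultiplication.Theorems.GraphEquationsLowestFormReadOut
import Summits.MatrixMultiplication.MatrixMultiplication.Theorems.GraphEquationsSquareWitness
import Summits.MatrixMultiplication.MatrixMultiplication.Theorems.GraphEquationsNullExp

/-!
# `H_init^♭` is necessary: the order-free initial-form piece is calibrated (`GraphEquations`, M29)

Decomp-mm node «GraphEquations» (lens 5, g36); attacked leaf `MultiplicityReduction`
(stmt-MatrixMultiplication-27806).  Target of the node, VERBATIM: `_root_.MatrixMultiplication`.
Route-neutral (`closes` unchanged); imports no `Theses/` file.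

Kernel M28 (`GraphEquationsLowestFormReadOut`) defined the order-free piece
`H_init^♭ = LowestFormReduction` and proved `H_init^♭ → H_mult` and `V ∧ H_init^♭ → ω = 2`.
Here the converse bookkeeping: the generator system of BCS Prop. (15.1) (tests `f_q` themselves,
`GraphEquationsGenerators`) is lowest-form nondegenerate at the origin with orders `m_o = 2` and
`P_o = F_q` (`generatorSystem_lowInitNondegAt_zero`), hence

* `eqAdmissibleLowInit_of_omega_lt : ω < β → EqAdmissibleLowInit β`;
* `nec_lowestFormReduction : ω = 2 → H_init^♭`, `lowestFormReduction_of_multiplicityReduction :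
  H_mult → H_init^♭`, so `lowestFormReduction_iff_multiplicityReduction : H_init^♭ ↔ H_mult` and
  `matrixMultiplication_iff_quadratic_lowestFormReduction : ω = 2 ↔ V ∧ H_init^♭`.

So the crux `MultiplicityReduction` is EQUIVALENT (through `ω`, like `H_mult ↔ Purification` of
kernel M12 `GraphEquationsPurification`) to its order-free form: «a cheap correct system can be
replaced by a cheap correct system whose LOWEST weighted initial forms at some point are pure with a
nondegenerate gradient matrix».  Per system the hypothesis is the weakest of the lineage's chain
`GenericallyReduced ⇒ PureIsolatedAt 2 (M9b) ⇒ PureIsolatedAt K ⇒ InitNondegAt K (M11/M12) ⇒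
LowInitNondegAt` (no order bound, no isolated fibre — rank at one `γ`), and it still forces
`ω ≤ β` (M28, border rank + Bini).  No `sorry`.

Sources: [BurgisserClausenShokrollahi1997, Prop. (15.1), Problem 16.3].
-/

set_option linter.dupNamespace false

noncomputable section

open scoped BigOperators

namespace Summit.MatrixMultiplication.MatrixMultiplication.Theorems.GraphEquations

open MvPolynomial
open Literature.Computability.AlgebraicComplexity
open Literature.Computability.AlgebraicComplexity.ArithCircuit

variable {n : ℕ}

/-! ## Weighted homogeneous pieces (`bind₁_shift_zero`, `isWeightedHomogeneous_generator`,
`rename_genericMatMulEntry` are the tree's: `GraphEquationsSquareWitness` / `…PureFormsNec` / `…NullExp`) -/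

/-- A weighted homogeneous polynomial is its own component. -/
theorem weightedHomogeneousComponent_eq_self_of_isWeightedHomogeneous
    {p : MvPolynomial (GraphVars n) ℂ} {d : ℕ} (hp : IsWeightedHomogeneous (gw n) p d) :
    weightedHomogeneousComponent (gw n) d p = p := by
  classical
  ext μ
  rw [coeff_weightedHomogeneousComponent]
  split_ifs with h
  · rfl
  · by_contra hne
    exact h (hp (Ne.symm hne))

/-! ## The generator system is lowest-form nondegenerate at the origin -/

section Construction

variable (P : ArithCircuit ℂ (MatMulVars n)) (idx : Fin n × Fin n → ℕ)

/-- The generator system (`GraphEquationsGenerators`) is lowest-form nondegenerate at `0`, with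
orders `m_o = 2` and pure forms `P_o = F_{q(o)}` (gradient matrix a reindexed identity). -/
theorem generatorSystem_lowInitNondegAt_zero (hidx : ∀ p, idx p < P.size)
    (hval : ∀ p : Fin n × Fin n,
      (gateValues P.gates)[idx p]? = some (genericMatMulEntry ℂ n p.1 p.2)) :
    (generatorSystem P idx).LowInitNondegAt 0 := by
  classical
  let e : Fin (generatorSystem P idx).tests.length ≃ Fin n × Fin n :=
    (finCongr (generatorSystem_tests_length P idx)).trans finProdFinEquiv.symm
  have htest : ∀ o : Fin (generatorSystem P idx).tests.length,
      bind₁ (shift 0) ((generatorSystem P idx).testPoly ((generatorSystem P idx).tests.get o)) =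
        generator n (e o) := by
    intro o
    have hs : (generatorSystem P idx).tests.get o =
        P.size + ((Fin.cast (generatorSystem_tests_length P idx) o : Fin (n * n)) : ℕ) := by
      simp [generatorSystem]
    rw [bind₁_shift_zero, hs, generatorSystem_testPoly P idx hidx hval, rename_genericMatMulEntry]
    rfl
  refine ⟨fun _ => 2, fun o => X (e o), fun _ => 1, fun o μ hμ => ?_, fun o => ?_, ?_⟩
  · rw [htest o] at hμ
    exact ((isWeightedHomogeneous_generator (e o)) (mem_support_iff.1 hμ)).symm.le
  · rw [htest o, aeval_X]
    exact weightedHomogeneousComponent_eq_self_of_isWeightedHomogeneous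
      (isWeightedHomogeneous_generator (e o))
  · have hG : gradMatrix (fun _ => (1 : ℂ)) (fun o => X (e o)) =
        (1 : Matrix (Fin n × Fin n) (Fin n × Fin n) ℂ).submatrix e (Equiv.refl _) := by
      ext o q
      simp only [gradMatrix, Matrix.of_apply, Matrix.submatrix_apply, Equiv.coe_refl, pderiv_X]
      by_cases h : e o = q
      · subst h
        rw [id, Matrix.one_apply_eq]; simp
      · simp [h]
    rw [hG, Matrix.rank_submatrix, Matrix.rank_one, Fintype.card_prod, Fintype.card_fin]

end Construction

/-- **`ω < β → EqAdmissibleLowInit β`** (BCS Prop. (15.1): compute `AB` fast and test `f_q`). -/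
theorem eqAdmissibleLowInit_of_omega_lt {β : ℝ} (hβ : omega ℂ < β) : EqAdmissibleLowInit β := by
  obtain ⟨C, hC⟩ := BurgisserClausenShokrollahi1997_prop151_holds ℂ (β - omega ℂ) (sub_pos.2 hβ)
  refine ⟨C + 1, fun n hn => ?_⟩
  obtain ⟨P, hP2, hPc, hPs⟩ := hC n hn
  have hex : ∀ p : Fin n × Fin n, ∃ j,
      (gateValues P.gates)[j]? = some (genericMatMulEntry ℂ n p.1 p.2) :=
    fun p => List.mem_iff_getElem?.1 (hPc p.1 p.2)
  choose idx hidx using hex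
  have hlt : ∀ p, idx p < P.size := fun p => by
    have := (List.getElem?_eq_some_iff.1 (hidx p)).1
    simpa [ArithCircuit.size] using this
  refine ⟨generatorSystem P idx, ⟨generatorSystem_isFanInTwo P idx hP2,
    generatorSystem_zeroSet P idx hlt hidx⟩, ⟨0, generatorSystem_lowInitNondegAt_zero P idx hlt hidx⟩,
    ?_⟩
  rw [generatorSystem_cost]
  have hn1 : (1 : ℝ) ≤ n := by exact_mod_cast hn
  have hω2 : (2 : ℝ) ≤ β := (omega_two_le ℂ).trans hβ.le
  have hsq : (n : ℝ) * n ≤ (n : ℝ) ^ β := by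
    have h := Real.rpow_le_rpow_of_exponent_le hn1 (show ((2 : ℕ) : ℝ) ≤ β by exact_mod_cast hω2)
    rw [Real.rpow_natCast, sq] at h
    exact h
  have hβeq : omega ℂ + (β - omega ℂ) = β := by ring
  rw [hβeq] at hPs
  push_cast
  linarith

/-- `EqAdmissibleLowInit β` for `β < ω` is impossible; so the dial is calibrated:
`EqAdmissibleLowInit β ↔ ω < β` up to the endpoint. -/
theorem omega_le_iff_eqAdmissibleLowInit_above (β : ℝ) :
    omega ℂ ≤ β ↔ ∀ β' : ℝ, β < β' → EqAdmissibleLowInit β' := by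
  constructor
  · exact fun h β' hβ' => eqAdmissibleLowInit_of_omega_lt (lt_of_le_of_lt h hβ')
  · intro h
    refine le_of_forall_gt_imp_ge_of_dense fun β' hβ' => ?_
    exact omega_le_of_eqAdmissibleLowInit (h β' hβ')

/-- **`ω = 2 → H_init^♭`.** -/
theorem nec_lowestFormReduction (h : _root_.MatrixMultiplication) : LowestFormReduction := by
  intro β hβ _ β' hβ'
  refine eqAdmissibleLowInit_of_omega_lt ?_
  have hω : omega ℂ = 2 := h
  rw [hω]
  exact lt_of_le_of_lt hβ hβ'

/-- **`H_mult → H_init^♭`** (through `ω`: `H_mult` gives reduced systems above `β`, hence `ω ≤ β`). -/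
theorem lowestFormReduction_of_multiplicityReduction (h : MultiplicityReduction) :
    LowestFormReduction := by
  intro β hβ hE β' hβ'
  obtain ⟨β₁, h₁, h₂⟩ := exists_between hβ'
  have hω : omega ℂ ≤ β₁ :=
    reducedEquationsForceMultiplication_holds β₁ (hβ.trans h₁.le) (h β hβ hE β₁ h₁)
  exact eqAdmissibleLowInit_of_omega_lt (lt_of_le_of_lt hω h₂)

/-- **`H_init^♭ ↔ H_mult`**: the crux is equivalent to its order-free purification form. -/
theorem lowestFormReduction_iff_multiplicityReduction :
    LowestFormReduction ↔ MultiplicityReduction :=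
  ⟨multiplicityReduction_of_lowestFormReduction, lowestFormReduction_of_multiplicityReduction⟩

/-- **`ω = 2 ↔ V ∧ H_init^♭`.** -/
theorem matrixMultiplication_iff_quadratic_lowestFormReduction :
    _root_.MatrixMultiplication ↔ GraphEquationsQuadratic ∧ LowestFormReduction :=
  ⟨fun h => ⟨nec_quadratic h, nec_lowestFormReduction h⟩,
    fun h => matrixMultiplication_of_quadratic_of_lowestFormReduction h.1 h.2⟩

end Summit.MatrixMultiplication.MatrixMultiplication.Theorems.GraphEquations
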